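import Mathlib
import HarnessLib

/-!
# The deflated Temple–Kato (Lehmann–Maehly) lower bound for the bottom of a semibounded quadratic form

Topic `Analysis/OperatorTheory`; theorems only (no definition, no named fact, no instance).  Companion of
`TempleInequality.lean` (Temple's inequality for a symmetric map WITH a Hilbert eigenbasis): here NO operator, eigenbasis or
compactness is assumed — only a real vector space `D` (think: a form core, e.g. finite-energy window functions), a positive
semidefinite symmetric bilinear form `ip` (the `L²` inner product) and a symmetric bilinear form `E` (the closed form), which is
the situation of a variational problem whose operator is not in hand.

**Deflation lemma** (`deflatedFormBound_of_decomp`, `deflatedFormBound_orthonormal`).  Let `v₁ … v_k ∈ D` ("trial vectors",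
e.g. Rayleigh–Ritz vectors) and `r₁ … r_k ∈ D` ("window residuals") with
* (repr)  `E(v_i, h) = ip(r_i, h)` for every `h ⊥ v₁ … v_k` — `r_i` represents the functional `E(v_i, ·)` on the complement
  (for the Ritz vectors of an operator `L` one may take `r_i = (1 − P_V) L v_i`, the part of `L v_i` orthogonal to the trial space);
* (β)     `E(h, h) ≥ β · ip(h, h)` for every `h ⊥ v₁ … v_k` — a ROUGH lower bound on the complement (by min–max any
  `β ≤ λ_{k+1}` qualifies; it is what a low-precision certificate supplies);
* (PSD)   the `k × k` matrix `(β − λ)(A − λ G) − R` is positive semidefinite, where `A_ij = E(v_i, v_j)`, `G_ij = ip(v_i, v_j)`,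
  `R_ij = ip(r_i, r_j)` and `λ < β`.
Then `E(g, g) ≥ λ · ip(g, g)` for every `g = Σ α_i v_i + h`, `h ⊥ v₁ … v_k` — i.e. for every `g ∈ D` as soon as such decompositions
exist (always, when `G` is invertible; `deflatedFormBound_orthonormal` gives it for `ip`-orthonormal `v`).  Proof: with `w = Σ α_i v_i`,
`x = Σ α_i r_i`: `E(g,g) − λ ip(g,g) ≥ αᵀ(A − λG)α + 2 ip(x, h) + (β − λ) ip(h, h)`, and `(β − λ)` times the right-hand side is
`≥ ip(x + (β−λ)h, x + (β−λ)h) ≥ 0` by (PSD).  For `k = 1`, `G = 1`, `A = ρ`, `R = σ²` this is Temple's inequality in Kato's form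
`λ₁ ≥ ρ − σ²/(β − ρ)` read as "`λ` is admissible iff `(β − λ)(ρ − λ) ≥ σ²`" [cite: WeinsteinStenger1972, Ch. 5 §9 eq. (2) (Temple's formula with ρ < λ₂ from an intermediate problem)];
[cite: ReedSimonIV1978, Thm. XIII.5]; the `k`-vector ("deflated") version is the Lehmann–Maehly block form of the same computation.
Use (this tree): certified lower bounds for the sector bottoms of the windowed Weil form from explicit Ritz data plus a cheap
certificate for `β` on a finite-codimension complement (FEASIBILITY-234 on item stmt-RiemannHypothesis-18085).

## References
* A. Weinstein, W. Stenger, *Methods of Intermediate Problems for Eigenvalues* (1972), Ch. 5 §9 (Temple's formula, `ρ` from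
  intermediate problems) [WeinsteinStenger1972].
* M. Reed, B. Simon, *Methods of Modern Mathematical Physics IV* (1978), Thm. XIII.5 [ReedSimonIV1978].
-/

noncomputable section

open Finset
open scoped BigOperators

namespace Literature.Analysis.OperatorTheory

variable {D : Type*} [AddCommGroup D] [Module ℝ D]

/-- A bilinear form evaluated on a finite linear combination in the first slot. [folklore] -/
theorem bilin_sum_smul_left (B : D →ₗ[ℝ] D →ₗ[ℝ] ℝ) {k : ℕ} (α : Fin k → ℝ) (v : Fin k → D) (y : D) :
    B (∑ i, α i • v i) y = ∑ i, α i * B (v i) y := by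
  simp [map_sum, map_smul]

/-- A bilinear form evaluated on a finite linear combination in the second slot. [folklore] -/
theorem bilin_sum_smul_right (B : D →ₗ[ℝ] D →ₗ[ℝ] ℝ) {k : ℕ} (α : Fin k → ℝ) (v : Fin k → D) (x : D) :
    B x (∑ i, α i • v i) = ∑ i, α i * B x (v i) := by
  simp [map_sum, map_smul]

/-- A bilinear form evaluated on two finite linear combinations: `B(Σ αᵢvᵢ, Σ γⱼuⱼ) = ΣΣ αᵢγⱼ B(vᵢ,uⱼ)`. [folklore] -/
theorem bilin_sum_smul_sum_smul (B : D →ₗ[ℝ] D →ₗ[ℝ] ℝ) {k : ℕ} (α γ : Fin k → ℝ) (v u : Fin k → D) :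
    B (∑ i, α i • v i) (∑ j, γ j • u j) = ∑ i, ∑ j, α i * γ j * B (v i) (u j) := by
  rw [bilin_sum_smul_left]
  refine sum_congr rfl fun i _ ↦ ?_
  rw [bilin_sum_smul_right, mul_sum]
  exact sum_congr rfl fun j _ ↦ by ring

/-- **Deflated Temple–Kato (Lehmann–Maehly) bound, decomposition form.**  `ip` a positive semidefinite symmetric bilinear
form, `E` a symmetric bilinear form on a real vector space `D`; trial vectors `v`, residual representers `r` with
`E(v_i, h) = ip(r_i, h)` on the `ip`-orthogonal complement of the `v_i`, a complement bound `E(h,h) ≥ β ip(h,h)` there, and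
`λ < β` with `(β − λ)(A − λG) − R ⪰ 0` (`A = E(v,v)`, `G = ip(v,v)`, `R = ip(r,r)`, as a quadratic-form inequality in the
coefficients).  Then `λ ip(g,g) ≤ E(g,g)` for every `g = Σ α_i v_i + h` with `h ⊥ v`.
[cite: WeinsteinStenger1972, Ch. 5 §9 eq. (2) (k = 1: Temple's formula)] -/
theorem deflatedFormBound_of_decomp (ip E : D →ₗ[ℝ] D →ₗ[ℝ] ℝ)
    (hip_symm : ∀ x y, ip x y = ip y x) (hip_nonneg : ∀ x, 0 ≤ ip x x) (hE_symm : ∀ x y, E x y = E y x)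
    {k : ℕ} (v r : Fin k → D) {β lam : ℝ} (hlam : lam < β)
    (hrepr : ∀ i h, (∀ j, ip (v j) h = 0) → E (v i) h = ip (r i) h)
    (hbeta : ∀ h, (∀ j, ip (v j) h = 0) → β * ip h h ≤ E h h)
    (hPSD : ∀ α : Fin k → ℝ,
      0 ≤ ∑ i, ∑ j, α i * α j * ((β - lam) * (E (v i) (v j) - lam * ip (v i) (v j)) - ip (r i) (r j)))
    {g h : D} {α : Fin k → ℝ} (hg : g = (∑ i, α i • v i) + h) (horth : ∀ j, ip (v j) h = 0) :
    lam * ip g g ≤ E g g := by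
  set w : D := ∑ i, α i • v i with hw
  set x : D := ∑ i, α i • r i with hx
  -- the pieces
  have hEwh : E w h = ip x h := by
    rw [hw, hx, bilin_sum_smul_left, bilin_sum_smul_left]
    exact sum_congr rfl fun i _ ↦ by rw [hrepr i h horth]
  have hipwh : ip w h = 0 := by
    rw [hw, bilin_sum_smul_left]
    exact sum_eq_zero fun i _ ↦ by rw [horth i, mul_zero]
  have hEgg : E g g = E w w + 2 * ip x h + E h h := by
    rw [hg]
    simp only [map_add, LinearMap.add_apply]
    rw [hE_symm h w, hEwh]
    ring
  have hipgg : ip g g = ip w w + ip h h := by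
    rw [hg]
    simp only [map_add, LinearMap.add_apply]
    rw [hip_symm h w, hipwh]
    ring
  -- the quadratic forms in the coefficients
  have hEww : E w w = ∑ i, ∑ j, α i * α j * E (v i) (v j) := by rw [hw, bilin_sum_smul_sum_smul]
  have hipww : ip w w = ∑ i, ∑ j, α i * α j * ip (v i) (v j) := by rw [hw, bilin_sum_smul_sum_smul]
  have hipxx : ip x x = ∑ i, ∑ j, α i * α j * ip (r i) (r j) := by rw [hx, bilin_sum_smul_sum_smul]
  have hP : 0 ≤ (β - lam) * (E w w - lam * ip w w) - ip x x := by
    have e : ∑ i, ∑ j, α i * α j * ((β - lam) * (E (v i) (v j) - lam * ip (v i) (v j)) - ip (r i) (r j)) =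
        (β - lam) * (∑ i, ∑ j, α i * α j * E (v i) (v j)) -
          (β - lam) * lam * (∑ i, ∑ j, α i * α j * ip (v i) (v j)) - ∑ i, ∑ j, α i * α j * ip (r i) (r j) := by
      simp only [Finset.mul_sum]
      rw [← Finset.sum_sub_distrib, ← Finset.sum_sub_distrib]
      refine Finset.sum_congr rfl fun i _ ↦ ?_
      rw [← Finset.sum_sub_distrib, ← Finset.sum_sub_distrib]
      exact Finset.sum_congr rfl fun j _ ↦ by ring
    have h0 := hPSD α
    rw [e] at h0
    have e' : (β - lam) * (E w w - lam * ip w w) - ip x x =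
        (β - lam) * (∑ i, ∑ j, α i * α j * E (v i) (v j)) -
          (β - lam) * lam * (∑ i, ∑ j, α i * α j * ip (v i) (v j)) - ∑ i, ∑ j, α i * α j * ip (r i) (r j) := by
      rw [hEww, hipww, hipxx]; ring
    rw [e']
    exact h0
  -- positivity of `ip` on `x + (β - λ) h`
  have hsq : 0 ≤ ip x x + 2 * (β - lam) * ip x h + (β - lam) ^ 2 * ip h h := by
    have e2 : ip x x + 2 * (β - lam) * ip x h + (β - lam) ^ 2 * ip h h =
        ip (x + (β - lam) • h) (x + (β - lam) • h) := by
      simp only [map_add, map_smul, LinearMap.add_apply, LinearMap.smul_apply, smul_eq_mul]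
      rw [hip_symm h x]
      ring
    rw [e2]
    exact hip_nonneg _
  have hβ := hbeta h horth
  have hβl : 0 < β - lam := sub_pos.2 hlam
  have hS : 0 ≤ E w w - lam * ip w w + 2 * ip x h + (β - lam) * ip h h := by
    by_contra hneg
    push Not at hneg
    have h1 := mul_neg_of_pos_of_neg hβl hneg
    nlinarith [hP, hsq, h1]
  rw [hEgg, hipgg]
  linarith [hS, hβ]

/-- **Deflated Temple–Kato bound for `ip`-orthonormal trial vectors.**  With `ip(v_i, v_j) = δ_ij` every `g ∈ D` decomposes as
`g = Σ ip(v_i, g) v_i + h`, `h ⊥ v`, so the bound holds on all of `D`: under (repr), (β) and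
`(β − λ)(A − λ·1) − R ⪰ 0`, `λ ip(g,g) ≤ E(g,g)` for every `g`. [cite: WeinsteinStenger1972, Ch. 5 §9 eq. (2) (k = 1: Temple's formula)] -/
theorem deflatedFormBound_orthonormal (ip E : D →ₗ[ℝ] D →ₗ[ℝ] ℝ)
    (hip_symm : ∀ x y, ip x y = ip y x) (hip_nonneg : ∀ x, 0 ≤ ip x x) (hE_symm : ∀ x y, E x y = E y x)
    {k : ℕ} (v r : Fin k → D) (hon : ∀ i j, ip (v i) (v j) = if i = j then 1 else 0)
    {β lam : ℝ} (hlam : lam < β)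
    (hrepr : ∀ i h, (∀ j, ip (v j) h = 0) → E (v i) h = ip (r i) h)
    (hbeta : ∀ h, (∀ j, ip (v j) h = 0) → β * ip h h ≤ E h h)
    (hPSD : ∀ α : Fin k → ℝ,
      0 ≤ ∑ i, ∑ j, α i * α j * ((β - lam) * (E (v i) (v j) - lam * ip (v i) (v j)) - ip (r i) (r j)))
    (g : D) : lam * ip g g ≤ E g g := by
  set α : Fin k → ℝ := fun i ↦ ip (v i) g with hα
  set h : D := g - ∑ i, α i • v i with hh
  have hg : g = (∑ i, α i • v i) + h := by rw [hh]; abel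
  have horth : ∀ j, ip (v j) h = 0 := by
    intro j
    rw [hh, map_sub, bilin_sum_smul_right]
    simp only [hon, mul_ite, mul_one, mul_zero, Finset.sum_ite_eq, Finset.mem_univ, if_true]
    simp [hα]
  exact deflatedFormBound_of_decomp ip E hip_symm hip_nonneg hE_symm v r hlam hrepr hbeta hPSD hg horth

/-- **Temple's inequality in form language (`k = 1`).**  One trial vector `v` with `ip(v,v) = 1`, Rayleigh value `ρ = E(v,v)`,
a residual representer `r` (`E(v,h) = ip(r,h)` for `h ⊥ v`) with `ip(r,r) ≤ σ²`, and a complement bound `β`: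
if `λ < β` and `σ² ≤ (β − λ)(ρ − λ)` then `λ ip(g,g) ≤ E(g,g)` for all `g`; the largest such `λ` is the smaller root, Kato's
`ρ − σ²/(β − ρ) + …`. [cite: ReedSimonIV1978, Thm. XIII.5] -/
theorem templeFormBound (ip E : D →ₗ[ℝ] D →ₗ[ℝ] ℝ)
    (hip_symm : ∀ x y, ip x y = ip y x) (hip_nonneg : ∀ x, 0 ≤ ip x x) (hE_symm : ∀ x y, E x y = E y x)
    (v r : D) (hv : ip v v = 1) {β lam σsq : ℝ} (hlam : lam < β)
    (hrepr : ∀ h, ip v h = 0 → E v h = ip r h) (hbeta : ∀ h, ip v h = 0 → β * ip h h ≤ E h h)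
    (hr : ip r r ≤ σsq) (hcond : σsq ≤ (β - lam) * (E v v - lam)) (g : D) :
    lam * ip g g ≤ E g g := by
  refine deflatedFormBound_orthonormal ip E hip_symm hip_nonneg hE_symm (k := 1) (fun _ ↦ v) (fun _ ↦ r)
    (fun i j ↦ by rw [if_pos (Subsingleton.elim i j), hv]) hlam
    (fun _ h hh ↦ hrepr h (hh 0)) (fun h hh ↦ hbeta h (hh 0)) (fun α ↦ ?_) g
  simp only [Finset.univ_unique, Fin.default_eq_zero, Finset.sum_singleton, hv, mul_one]
  nlinarith [sq_nonneg (α 0), hr, hcond]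

end Literature.Analysis.OperatorTheory
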